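import Summits.BirchSwinnertonDyer.BirchSwinnertonDyer.Theorems.ByReductionTypeAtTwoFineSelmerConjAAtTwoAdditivePotGoodChevalleyDoorAtTwo
import Summits.BirchSwinnertonDyer.BirchSwinnertonDyer.Theorems.ByReductionTypeAtTwoFineSelmerConjAAtTwoAdditivePotGoodChevalleyPadicCertificate
import Summits.BirchSwinnertonDyer.BirchSwinnertonDyer.Theorems.ByReductionTypeAtTwoFineSelmerConjAAtTwoAdditivePotGoodClassNumberOneCriterion
import HarnessLib

/-!
# The one-bit door closed by a certificate: `e₁ = 0` for `ℚ(θ)` from finite data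

Sub-problem `BirchSwinnertonDyer`, route `ByReductionTypeAtTwo`, item `FineSelmerConjAAtTwoAdditivePotGood` (C1″), helper file.
The ONE displayed bit of the one-bit census stamps `conjA_two_<L>_of_layerOneBit` is
`∀ κL cyclotomic ℤ₂-extension of ℚ(θ), classNumberPExp κL 1 = 0` (`2 ∤ h(ℚ(θ, √2))`).  Chevalley's door at `p = 2`
(`classNumberPExp_one_eq_zero_of_nonNorm_unit_two`) reduces it to: `[K : ℚ]` odd, `2 ∤ h_K`, at most two primes of `K` above `2`,
and a unit of `K` that is not a norm from `K(√2)`.  Here every hypothesis is made a FINITE CHECK on the cubic `g = X³ + pX² + qX + r`: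

* §1 `ncard_primes_above_two_le_two` — if `4 ∤ g(a₀)` for some even `a₀` and `4 ∤ g(a₁)` for some odd `a₁`, then `K = ℚ(θ)` has at
  most two primes above `2` (three primes would all have norm `2`, two of them would see the same residue `c` of `θ`, and then
  `4 ∣ N(θ − c − 2t) = ∓g(c + 2t)` for every `t`);
* §2 `layerOneBit_of_chevalleyCert` — the bit itself from: the class-number certificate (`2 ∤ #Cl(𝓞 ℚ(θ))`, decided elsewhere), §1,
  a unit `ε = (x + yθ + zθ²)/m` given with its monic cubic `X³ + c₁X² + c₂X ± 1`, and the `2`-adic non-norm certificate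
  `(x + ya + za²)·m⁻¹ ≡ ±3 (mod 8)` at a Hensel datum `a` (`8 ∣ g(a)`, `g'(a)` odd) of file `…ChevalleyPadicCertificate`.

## What this does NOT prove
It decides ONE hypothesis of the conditional stamps; the `Lim2017` input `hLim2` of every census row stays.  BSD is not advanced.
-/

set_option autoImplicit false
set_option linter.dupNamespace false

noncomputable section

open scoped Classical IntermediateField NumberField nonZeroDivisors

namespace Summit.BirchSwinnertonDyer.BirchSwinnertonDyer.Theorems.AddKatoTwo

open Polynomial IsDedekindDomain NumberField Literature.NumberTheory.NumberFields Literature.NumberTheory.IwasawaTheory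
  Literature.NumberTheory.EllipticCurves

/-! ## §1 At most two primes above `2` -/

section Abstract

variable (K : Type) [Field K] [NumberField K]

/-- In a ring of integers, an ideal of norm `2` sees every element as `0` or `1`. [folklore] -/
theorem mem_or_sub_one_mem_of_absNorm_eq_two (I : Ideal (𝓞 K)) (hI : Ideal.absNorm I = 2) (x : 𝓞 K) :
    x ∈ I ∨ x - 1 ∈ I := by
  rw [Ideal.absNorm_apply, Submodule.cardQuot_apply] at hI
  have hne : I ≠ ⊤ := by
    intro h
    have : Ideal.absNorm I = 1 := Ideal.absNorm_eq_one_iff.mpr h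
    rw [Ideal.absNorm_apply, Submodule.cardQuot_apply, hI] at this
    exact absurd this (by norm_num)
  haveI : Nontrivial (𝓞 K ⧸ I) := Ideal.Quotient.nontrivial_iff.mpr hne
  obtain ⟨y, hy, huniq⟩ := (Nat.card_eq_two_iff' (0 : 𝓞 K ⧸ I)).mp hI
  have h1 : (1 : 𝓞 K ⧸ I) = y := huniq 1 one_ne_zero
  by_cases hx : Ideal.Quotient.mk I x = 0
  · exact Or.inl (Ideal.Quotient.eq_zero_iff_mem.mp hx)
  · right
    have hxy : Ideal.Quotient.mk I x = y := huniq _ hx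
    rw [← Ideal.Quotient.eq, map_one, hxy, h1]

/-- **At most two primes above `2` in a cubic field, certified.**  `K` cubic, `b ∈ 𝓞 K` a root of the irreducible
`g = X³ + pX² + qX + r`; if `4 ∤ g(2t₀)` for some `t₀` and `4 ∤ g(2t₁ + 1)` for some `t₁`, then `K` has at most two primes above `2`.
(Three primes `v₁, v₂, v₃ ∋ 2` are pairwise coprime, so `v₁v₂v₃ ∣ (2)` and each has norm `2`; `b ≡ cᵢ ∈ {0, 1} (mod vᵢ)`, two of the
`cᵢ` coincide, say `c`, and then `vᵢvⱼ ∣ (b − c − 2t)` forces `4 ∣ |N(b − c − 2t)| = |g(c + 2t)|` for every `t`.)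
[cite: Marcus1977, Ch. 3 Thm. 27 (the case it certifies)] -/
theorem ncard_primes_above_two_le_two (h3 : Module.finrank ℚ K = 3) (b : 𝓞 K) {p q r : ℤ}
    (hirr : Irreducible (Cubic.toPoly ⟨1, (p : ℚ), q, r⟩)) (hb : b ^ 3 + p * b ^ 2 + q * b + r = 0)
    (h0 : ∃ t : ℤ, ¬ (4 : ℤ) ∣ (2 * t) ^ 3 + p * (2 * t) ^ 2 + q * (2 * t) + r)
    (h1 : ∃ t : ℤ, ¬ (4 : ℤ) ∣ (2 * t + 1) ^ 3 + p * (2 * t + 1) ^ 2 + q * (2 * t + 1) + r) :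
    {v : HeightOneSpectrum (𝓞 K) | ((2 : ℕ) : 𝓞 K) ∈ v.asIdeal}.ncard ≤ 2 := by
  by_contra hlt
  rw [not_le] at hlt
  set S := {v : HeightOneSpectrum (𝓞 K) | ((2 : ℕ) : 𝓞 K) ∈ v.asIdeal} with hSdef
  have hfin : S.Finite := Set.finite_of_ncard_pos (by omega)
  obtain ⟨v₁, v₂, v₃, hv₁, hv₂, hv₃, h12, h13, h23⟩ := (Set.two_lt_ncard_iff hfin).mp hlt
  simp only [hSdef, Set.mem_setOf_eq] at hv₁ hv₂ hv₃
  -- pairwise coprime maximal ideals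
  have hmax : ∀ v : HeightOneSpectrum (𝓞 K), v.asIdeal.IsMaximal := fun v => v.isPrime.isMaximal v.ne_bot
  have hne : ∀ {v w : HeightOneSpectrum (𝓞 K)}, v ≠ w → v.asIdeal ≠ w.asIdeal := fun h h' =>
    h (HeightOneSpectrum.ext h')
  have hcop : ∀ {v w : HeightOneSpectrum (𝓞 K)}, v ≠ w → v.asIdeal ⊔ w.asIdeal = ⊤ := fun h =>
    (hmax _).coprime_of_ne (hmax _) (hne h)
  -- `(2) ≤ v₁ v₂ v₃`
  have h2mem : ((2 : ℕ) : 𝓞 K) ∈ v₁.asIdeal * v₂.asIdeal * v₃.asIdeal := by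
    have h12' : v₁.asIdeal * v₂.asIdeal = v₁.asIdeal ⊓ v₂.asIdeal := Ideal.mul_eq_inf_of_coprime (hcop h12)
    have h123 : v₁.asIdeal * v₂.asIdeal ⊔ v₃.asIdeal = ⊤ := by
      rw [Ideal.mul_sup_eq_of_coprime_left (hcop h13)]; exact hcop h23
    rw [Ideal.mul_eq_inf_of_coprime h123, h12']
    exact ⟨⟨hv₁, hv₂⟩, hv₃⟩
  -- norms: `N(v₁) N(v₂) N(v₃) ∣ 8`
  have hN2 : Ideal.absNorm (Ideal.span {((2 : ℕ) : 𝓞 K)}) = 8 := by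
    rw [Ideal.absNorm_span_singleton]
    have := norm_coords_eq_normPoly K h3 b hirr hb 2 0 0
    have h2 : ((2 : ℤ) : 𝓞 K) + ((0 : ℤ) : 𝓞 K) * b + ((0 : ℤ) : 𝓞 K) * b ^ 2 = ((2 : ℕ) : 𝓞 K) := by push_cast; ring
    rw [h2] at this
    rw [this]; norm_num
  have hdvd : Ideal.absNorm v₁.asIdeal * Ideal.absNorm v₂.asIdeal * Ideal.absNorm v₃.asIdeal ∣ 8 := by
    rw [← hN2, ← map_mul, ← map_mul]
    exact Ideal.absNorm_dvd_absNorm_of_le ((Ideal.span_singleton_le_iff_mem _).mpr h2mem)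
  have hge : ∀ v : HeightOneSpectrum (𝓞 K), 2 ≤ Ideal.absNorm v.asIdeal := by
    intro v
    have h0 : Ideal.absNorm v.asIdeal ≠ 0 := fun h => v.ne_bot (Ideal.absNorm_eq_zero_iff.mp h)
    have h1 : Ideal.absNorm v.asIdeal ≠ 1 := fun h => (hmax v).ne_top (Ideal.absNorm_eq_one_iff.mp h)
    omega
  have hle8 : Ideal.absNorm v₁.asIdeal * Ideal.absNorm v₂.asIdeal * Ideal.absNorm v₃.asIdeal ≤ 8 :=
    Nat.le_of_dvd (by norm_num) hdvd
  have hnorm2 : ∀ {u v w : HeightOneSpectrum (𝓞 K)},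
      Ideal.absNorm u.asIdeal * Ideal.absNorm v.asIdeal * Ideal.absNorm w.asIdeal ≤ 8 → Ideal.absNorm u.asIdeal = 2 := by
    intro u v w h
    have hu := hge u; have hv := hge v; have hw := hge w
    have hvw : 4 ≤ Ideal.absNorm v.asIdeal * Ideal.absNorm w.asIdeal := by nlinarith
    have : Ideal.absNorm u.asIdeal * 4 ≤ 8 := by
      calc Ideal.absNorm u.asIdeal * 4 ≤ Ideal.absNorm u.asIdeal * (Ideal.absNorm v.asIdeal * Ideal.absNorm w.asIdeal) :=
            Nat.mul_le_mul_left _ hvw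
        _ = _ := by ring
        _ ≤ 8 := h
    omega
  have hn₁ : Ideal.absNorm v₁.asIdeal = 2 := hnorm2 hle8
  have hn₂ : Ideal.absNorm v₂.asIdeal = 2 := hnorm2 (u := v₂) (v := v₁) (w := v₃) (by linarith [hle8])
  have hn₃ : Ideal.absNorm v₃.asIdeal = 2 := hnorm2 (u := v₃) (v := v₁) (w := v₂) (by linarith [hle8])
  -- the key step: two distinct primes of norm `2` seeing the same residue `c` of `b` force `4 ∣ g(c + 2t)` for all `t`
  have key : ∀ {v w : HeightOneSpectrum (𝓞 K)}, v ≠ w → ((2 : ℕ) : 𝓞 K) ∈ v.asIdeal → ((2 : ℕ) : 𝓞 K) ∈ w.asIdeal →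
      Ideal.absNorm v.asIdeal = 2 → Ideal.absNorm w.asIdeal = 2 → ∀ c : ℤ, b - c ∈ v.asIdeal → b - c ∈ w.asIdeal →
      ∀ t : ℤ, (4 : ℤ) ∣ (c + 2 * t) ^ 3 + p * (c + 2 * t) ^ 2 + q * (c + 2 * t) + r := by
    intro v w hvw h2v h2w hnv hnw c hcv hcw t
    have hx : ∀ {u : HeightOneSpectrum (𝓞 K)}, ((2 : ℕ) : 𝓞 K) ∈ u.asIdeal → b - c ∈ u.asIdeal →
        ((-(c + 2 * t) : ℤ) : 𝓞 K) + ((1 : ℤ) : 𝓞 K) * b + ((0 : ℤ) : 𝓞 K) * b ^ 2 ∈ u.asIdeal := by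
      intro u h2u hcu
      have : ((-(c + 2 * t) : ℤ) : 𝓞 K) + ((1 : ℤ) : 𝓞 K) * b + ((0 : ℤ) : 𝓞 K) * b ^ 2 =
          (b - c) - (t : 𝓞 K) * ((2 : ℕ) : 𝓞 K) := by push_cast; ring
      rw [this]
      exact sub_mem hcu (Ideal.mul_mem_left _ _ h2u)
    have hmem : ((-(c + 2 * t) : ℤ) : 𝓞 K) + ((1 : ℤ) : 𝓞 K) * b + ((0 : ℤ) : 𝓞 K) * b ^ 2 ∈ v.asIdeal * w.asIdeal := by
      rw [Ideal.mul_eq_inf_of_coprime (hcop hvw)]; exact ⟨hx h2v hcv, hx h2w hcw⟩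
    have hd := Ideal.absNorm_dvd_absNorm_of_le ((Ideal.span_singleton_le_iff_mem _).mpr hmem)
    rw [map_mul, hnv, hnw, Ideal.absNorm_span_singleton, natAbs_norm_coords_eq_natAbs_normPoly K h3 b hirr hb] at hd
    have hd' := Int.natAbs_dvd_natAbs.mp (show (4 : ℤ).natAbs ∣ _ from hd)
    have e : (-(c + 2 * t)) ^ 3 - p * (-(c + 2 * t)) ^ 2 * 1 + (p ^ 2 - 2 * q) * (-(c + 2 * t)) ^ 2 * 0
        + q * (-(c + 2 * t)) * 1 ^ 2 + (3 * r - p * q) * (-(c + 2 * t)) * 1 * 0 + (q ^ 2 - 2 * p * r) * (-(c + 2 * t)) * 0 ^ 2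
        - r * 1 ^ 3 + p * r * 1 ^ 2 * 0 - q * r * 1 * 0 ^ 2 + r ^ 2 * 0 ^ 3
        = -((c + 2 * t) ^ 3 + p * (c + 2 * t) ^ 2 + q * (c + 2 * t) + r) := by ring
    rw [e, dvd_neg] at hd'
    exact hd'
  -- residues of `b` modulo the three primes
  have hres : ∀ {v : HeightOneSpectrum (𝓞 K)}, Ideal.absNorm v.asIdeal = 2 →
      ∃ c : ℤ, (c = 0 ∨ c = 1) ∧ b - c ∈ v.asIdeal := by
    intro v hv
    rcases mem_or_sub_one_mem_of_absNorm_eq_two K v.asIdeal hv b with h | h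
    · exact ⟨0, Or.inl rfl, by simpa using h⟩
    · exact ⟨1, Or.inr rfl, by simpa using h⟩
  obtain ⟨c₁, hc₁, hb₁⟩ := hres hn₁
  obtain ⟨c₂, hc₂, hb₂⟩ := hres hn₂
  obtain ⟨c₃, hc₃, hb₃⟩ := hres hn₃
  obtain ⟨t₀, ht₀⟩ := h0
  obtain ⟨t₁, ht₁⟩ := h1
  -- a shared residue `c` kills `h0` (if `c = 0`) or `h1` (if `c = 1`)
  have finish : ∀ c : ℤ, (c = 0 ∨ c = 1) →
      (∀ t : ℤ, (4 : ℤ) ∣ (c + 2 * t) ^ 3 + p * (c + 2 * t) ^ 2 + q * (c + 2 * t) + r) → False := by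
    rintro c (rfl | rfl) hall
    · apply ht₀; have := hall t₀; simpa [zero_add] using this
    · apply ht₁; have := hall t₁
      have e : (1 : ℤ) + 2 * t₁ = 2 * t₁ + 1 := by ring
      rwa [e] at this
  by_cases hc12 : c₁ = c₂
  · subst hc12; exact finish c₁ hc₁ (key h12 hv₁ hv₂ hn₁ hn₂ c₁ hb₁ hb₂)
  by_cases hc13 : c₁ = c₃
  · subst hc13; exact finish c₁ hc₁ (key h13 hv₁ hv₃ hn₁ hn₃ c₁ hb₁ hb₃)
  have hc23 : c₂ = c₃ := by omega
  subst hc23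
  exact finish c₂ hc₂ (key h23 hv₂ hv₃ hn₂ hn₃ c₂ hb₂ hb₃)

end Abstract

/-! ## §2 The bit `e₁ = 0` for `ℚ(θ)` from the certificates -/

/-- **The one-bit door, certified.**  `θ ∈ ℚ̄` a root of the irreducible integer cubic `g = X³ + pX² + qX + r`, `K = ℚ(θ)`.  From
(i) `2 ∤ #Cl(𝓞 K)`; (ii) the two `4 ∤ g(·)` witnesses of §1 (at most two primes above `2`); (iii) a unit
`ε = (x + yθ + zθ²)/m ∈ 𝓞 K`, witnessed by its monic cubic `ε³ + c₁ε² + c₂ε + s = 0`, `s = ±1`; (iv) a Hensel datum `a`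
(`8 ∣ g(a)`, `g'(a)` odd) with `m m' ≡ 1` and `(x + ya + za²)·m' ≡ ±3 (mod 8)` — conclude: for every cyclotomic `ℤ₂`-extension
`κL` of `K`, `classNumberPExp κL 1 = 0`, i.e. `2 ∤ h(K(√2))` (Chevalley's ambiguous class number formula at `p = 2`).
[cite: Lang1990, Ch. 13 §4 Lemma 4.1; Serre1973, Ch. III §1.2 Thm. 1] -/
theorem layerOneBit_of_chevalleyCert {p q r : ℤ} (hirr : Irreducible (Cubic.toPoly ⟨1, (p : ℚ), q, r⟩))
    {θ : AlgebraicClosure ℚ} (hθ : aeval θ (Cubic.toPoly ⟨1, (p : ℚ), q, r⟩) = 0)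
    (hh : ¬ 2 ∣ Nat.card (ClassGroup (𝓞 (IntermediateField.adjoin ℚ {θ}))))
    (h0 : ∃ t : ℤ, ¬ (4 : ℤ) ∣ (2 * t) ^ 3 + p * (2 * t) ^ 2 + q * (2 * t) + r)
    (h1 : ∃ t : ℤ, ¬ (4 : ℤ) ∣ (2 * t + 1) ^ 3 + p * (2 * t + 1) ^ 2 + q * (2 * t + 1) + r)
    (x y z m c₁ c₂ s : ℤ) (hs : s = 1 ∨ s = -1)
    (he : aeval (algebraMap ℚ (AlgebraicClosure ℚ) ((x : ℚ) / m) + algebraMap ℚ (AlgebraicClosure ℚ) ((y : ℚ) / m) * θ +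
        algebraMap ℚ (AlgebraicClosure ℚ) ((z : ℚ) / m) * θ ^ 2) (Cubic.toPoly ⟨1, (c₁ : ℚ), c₂, s⟩) = 0)
    (a m' : ℤ) (h8 : (8 : ℤ) ∣ a ^ 3 + p * a ^ 2 + q * a + r) (hodd : ¬ (2 : ℤ) ∣ 3 * a ^ 2 + 2 * p * a + q)
    (hmm : ((m * m' : ℤ) : ZMod (2 ^ 3)) = 1)
    (hcert : (((x + y * a + z * a ^ 2) * m' : ℤ) : ZMod (2 ^ 3)) = 3 ∨
      (((x + y * a + z * a ^ 2) * m' : ℤ) : ZMod (2 ^ 3)) = 5) :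
    haveI : FiniteDimensional ℚ (IntermediateField.adjoin ℚ {θ}) :=
        IntermediateField.adjoin.finiteDimensional ((AlgebraicClosure.isAlgebraic ℚ).isAlgebraic θ).isIntegral;
      haveI : NumberField (IntermediateField.adjoin ℚ {θ}) := NumberField.mk;
      ∀ κL : ZpExtension (IntermediateField.adjoin ℚ {θ}) 2, κL.IsCyclotomic → classNumberPExp κL 1 = 0 := by
  haveI : FiniteDimensional ℚ (IntermediateField.adjoin ℚ {θ}) :=
    IntermediateField.adjoin.finiteDimensional ((AlgebraicClosure.isAlgebraic ℚ).isAlgebraic θ).isIntegral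
  haveI : NumberField (IntermediateField.adjoin ℚ {θ}) := NumberField.mk
  set K := IntermediateField.adjoin ℚ {θ} with hKdef
  have hmem : θ ∈ K := IntermediateField.mem_adjoin_simple_self ℚ θ
  have h3 : Module.finrank ℚ K = 3 := finrank_adjoin_eq_three_of_irreducible hirr hθ
  have hK2 : ¬ 2 ∣ Module.finrank ℚ K := by rw [h3]; norm_num
  have hh' : ¬ 2 ∣ classNumber K := by
    rwa [NumberField.classNumber, ← Nat.card_eq_fintype_card]
  obtain ⟨b, hbθ, hb⟩ := exists_ringOfIntegers_cubic_root (p := p) (q := q) (r := r) hθ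
  have hS : {v : HeightOneSpectrum (𝓞 K) | ((2 : ℕ) : 𝓞 K) ∈ v.asIdeal}.ncard ≤ 2 :=
    ncard_primes_above_two_le_two K h3 b hirr hb h0 h1
  -- the unit
  set eK : K := algebraMap ℚ K ((x : ℚ) / m) + algebraMap ℚ K ((y : ℚ) / m) * ⟨θ, hmem⟩ +
    algebraMap ℚ K ((z : ℚ) / m) * ⟨θ, hmem⟩ ^ 2 with heKdef
  have hecoe : (eK : AlgebraicClosure ℚ) = algebraMap ℚ (AlgebraicClosure ℚ) ((x : ℚ) / m) +
      algebraMap ℚ (AlgebraicClosure ℚ) ((y : ℚ) / m) * θ + algebraMap ℚ (AlgebraicClosure ℚ) ((z : ℚ) / m) * θ ^ 2 := by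
    rw [heKdef]; simp only [eq_ratCast]; push_cast; ring
  have heQ : (eK : AlgebraicClosure ℚ) ^ 3 + (c₁ : AlgebraicClosure ℚ) * (eK : AlgebraicClosure ℚ) ^ 2 +
      (c₂ : AlgebraicClosure ℚ) * (eK : AlgebraicClosure ℚ) + (s : AlgebraicClosure ℚ) = 0 := by
    have := he
    simp only [Cubic.toPoly, map_one, one_mul, aeval_add, aeval_mul, aeval_C, aeval_X_pow, aeval_X,
      eq_ratCast, Rat.cast_intCast] at this
    rw [hecoe]; simp only [eq_ratCast]
    exact this
  have heK : eK ^ 3 + (c₁ : K) * eK ^ 2 + (c₂ : K) * eK + (s : K) = 0 := by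
    apply Subtype.ext
    push_cast
    exact heQ
  set E : 𝓞 K := ⟨eK, ⟨Cubic.toPoly ⟨1, c₁, c₂, s⟩, Cubic.monic_of_a_eq_one', by
    rw [← aeval_def]
    simp only [Cubic.toPoly, map_one, one_mul, aeval_add, aeval_mul, aeval_C, aeval_X_pow, aeval_X]
    simp only [eq_intCast]
    exact heK⟩⟩ with hEdef
  have hE : E ^ 3 + (c₁ : 𝓞 K) * E ^ 2 + (c₂ : 𝓞 K) * E + (s : 𝓞 K) = 0 := by
    apply NumberField.RingOfIntegers.coe_injective
    push_cast
    simp only [hEdef, NumberField.RingOfIntegers.map_mk]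
    exact heK
  have hEu : IsUnit E := by
    refine IsUnit.of_mul_eq_one (-(s : 𝓞 K) * (E ^ 2 + (c₁ : 𝓞 K) * E + (c₂ : 𝓞 K))) ?_
    rcases hs with rfl | rfl
    · push_cast at hE ⊢; linear_combination (-1 : 𝓞 K) * hE
    · push_cast at hE ⊢; linear_combination hE
  have hEcoe : (E : K) = eK := by simp only [hEdef, NumberField.RingOfIntegers.map_mk]
  have hnn : ∀ α β : K, (E : K) ≠ α ^ 2 - 2 * β ^ 2 := by
    rw [hEcoe, heKdef]
    exact not_sqSubTwoSq_of_padicCert hirr hθ x y z m a m' h8 hodd hmm hcert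
  intro κL hκL
  exact classNumberPExp_one_eq_zero_of_nonNorm_unit_two hK2 κL hκL hh' hS hEu hnn

end Summit.BirchSwinnertonDyer.BirchSwinnertonDyer.Theorems.AddKatoTwo

end
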